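import Mathlib
import Summits.Ventures.HodgeRepro.Tier4.Line4.CentreAwayFiniteRow

/-!
# Tier4/Line4/TorusFinAtCompact — C-L4-TS-COMPACT: the `S`-torus `T_S ≤ T_f` at `S = placesAbove k p` is COMPACT when no place
of `k` above `p` splits in `E′` — the (E1) displayed binder `hTS` of AwayDomain / AwayDomainRow, discharged by name

Blind re-derivation cell `pub-hodge-repro`, Tier 4 «prove the step» (README §9–§10), seat t4-L2-p1 (prover, LINE L2 nominal, gen 4;
L4 service cut C-L4-TS-COMPACT, TAKEN S16100: the «second conclusion» of C-L4-NONSPLIT-FINITE that plan-4 g6 asked for at S15783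
and L2-p2 bound by name at S15787).  Tree path `lean/Summits/Ventures/HodgeRepro/Tier4/Line4/TorusFinAtCompact.lean`.  Imports
L1-p2's `Line4/CentreAwayFiniteRow` (hence `Line4/CentreAwayFinite`: the torus-data property `HasTorusData`, the GLOBAL BOUND
`exists_pow_mat_mem_scaledBox`, the compact box set `isCompact_setOf_mat_mem_scaledBox`, and the row-plane instances) and, through it,
L2-p1's `Line4/TorusFinSplit` (`torusFinAt`, `awayTf`, `isClosed_torusFinAt`) and `Line4/PlacePart`
(`offPlacesPart_eq_one_of_mem_supportedOn`).  No literature, no `def`, no `instance`.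

THE STATEMENT.  `W` a plane with the torus-data property `HasTorusData W d`, `p ≠ 0`, and the DISPLAYED (E1) local clause
`hns : ∀ v ∈ placesAbove p, ¬ IsSquare (−d)` in `k_v`: **`isCompact_torusFinAt_of_nonsplit`** — `T_S = torusFinAt W (placesAbove p)`
is a compact subset of `T_f`; **`compactSpace_torusFinAt_of_nonsplit`** — `CompactSpace (torusFinAt W (placesAbove p))`, the binder
`hTS` of `exists_isFundamentalDomain_prod_univ_of_compactSpace_at` (AwayDomain) and of AwayDomainRow verbatim.  Row-plane forms:
`compactSpace_torusFinAt_ofLinesRow_of_nonsplit` on `ofLinesRow q a b ε` and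
`compactSpace_torusFinAt_withTransportedTorus_of_nonsplit` on the seesaw plane of record
`(mixedRow q a b).withTransportedTorus g g' hgg' hg'g hgΩ`, with `hns` in plan-4's form `¬ IsSquare (t² − 4n)` in `k_v` (`t = 0`).
Neither `hreal` nor `hcm` (compactness of `T_∞`) is needed: the compactness of `T_S` is a purely `p`-adic statement.

THE PROOF (every step by name).  An element `z ∈ T_S` is supported on `S`, so its away part is trivial: `awayTf z = 1`
(`coe_awayTf`, `offPlacesPart_eq_one_of_mem_supportedOn`), hence `finInc (awayTf z) = 1 ∈ K(1)` and L1-p2's GLOBAL BOUND gives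
`mat z ∈ scaledBox (p^M)`; the same for `z⁻¹ ∈ T_S`.  So `T_S ⊆ {z ∈ T_f | mat z, mat z⁻¹ ∈ scaledBox (p^M)}`, the set L1-p2 proved
COMPACT (`isCompact_setOf_mat_mem_scaledBox`, through the closed embedding `T_f ↪ G(𝔸)` and the compact box), and `T_S` is CLOSED in
`T_f` (`isClosed_torusFinAt`); a closed subset of a compact set is compact.  `hns` is load-bearing exactly as in the finiteness
statement: at a place of `k` split in `E′` the norm-one curve `x² + d y² = 1` of `k_v` is unbounded (crit-2 Entry 338), and `T_S`
would contain a copy of `k_v^×`.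

Nothing here says anything about the status of the Hodge conjecture for CM abelian varieties, which is NOT proved
(HC_CM is NOT proved by anyone in this repository).
-/

set_option autoImplicit false

noncomputable section

namespace Summit.Ventures.HodgeRepro.Tier4.Line4

open Summit.Ventures.HodgeRepro.Tier4 Summit.Ventures.HodgeRepro.Tier4.Common Summit.Ventures.HodgeRepro.Tier4.Line1
  NumberField IsDedekindDomain Matrix

open scoped NumberField Classical

/-! ## Part A — the away part of an `S`-supported torus element is trivial -/

section Away

variable {k : Type} [Field k] [NumberField k] (W : PlaneData k) (S : Set (HeightOneSpectrum (𝓞 k)))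

/-- An element of `T_S` has trivial away part: `awayTf z = 1`. -/
theorem awayTf_eq_one_of_mem_torusFinAt {z : torusFin W} (hz : z ∈ torusFinAt W S) : awayTf W S z = 1 := by
  apply Subtype.ext
  apply Subtype.ext
  apply Subtype.ext
  rw [coe_awayTf]
  exact offPlacesPart_eq_one_of_mem_supportedOn W S ((mem_torusFinAt W S z).1 hz)

/-- The away part of an element of `T_S` lies in the level-one subgroup `K(1)` (it is `1`). -/
theorem finInc_awayTf_mem_levelK_of_mem_torusFinAt {z : torusFin W} (hz : z ∈ torusFinAt W S) :
    finInc W (awayTf W S z : torusFin W) ∈ levelK W 1 := by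
  rw [awayTf_eq_one_of_mem_torusFinAt W S hz, Subgroup.coe_one, map_one]
  exact (levelK W 1).one_mem

end Away

/-! ## Part B — THE COMPACTNESS of `T_S` at `S = placesAbove p` under `hns` -/

section Compact

variable {k : Type} [Field k] [NumberField k]

/-- **`T_S` lies in the box set** `{z | mat z, mat z⁻¹ ∈ scaledBox (p^M)}` for the exponent `M` of L1-p2's GLOBAL BOUND. -/
theorem torusFinAt_subset_setOf_mat_mem_scaledBox (W : PlaneData k) {p : ℕ} {M : ℕ}
    (hM : ∀ z : torusFin W, finInc W (awayTf W (placesAbove p) z : torusFin W) ∈ levelK W 1 →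
      GA.mat W (finInc W z) ∈ scaledBox k ((p : k) ^ M)) :
    (torusFinAt W (placesAbove p) : Set (torusFin W)) ⊆
      {z : torusFin W | GA.mat W (finInc W z) ∈ scaledBox k ((p : k) ^ M) ∧
        GA.mat W (finInc W z)⁻¹ ∈ scaledBox k ((p : k) ^ M)} := by
  intro z hz
  have hz' : z ∈ torusFinAt W (placesAbove p) := hz
  refine ⟨hM z (finInc_awayTf_mem_levelK_of_mem_torusFinAt W _ hz'), ?_⟩
  have hinv : finInc W z⁻¹ = (finInc W z)⁻¹ := rfl
  have := hM z⁻¹ (finInc_awayTf_mem_levelK_of_mem_torusFinAt W _ (inv_mem hz'))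
  rwa [hinv] at this

/-- **C-L4-TS-COMPACT, general form (set version)**: for a plane with the torus-data property, when `−d` is not a square at any
place of `k` above `p` (`hns`), the `S`-torus `T_S = torusFinAt W (placesAbove p)` is a COMPACT subset of `T_f`. -/
theorem isCompact_torusFinAt_of_nonsplit (W : PlaneData k) {d : k} (hdata : HasTorusData W d) {p : ℕ} (hp : p ≠ 0)
    (hns : ∀ v ∈ placesAbove (k := k) p, ¬ IsSquare (-(algebraMap k (v.adicCompletion k) d))) :
    IsCompact (torusFinAt W (placesAbove p) : Set (torusFin W)) := by
  obtain ⟨M, hM⟩ := exists_pow_mat_mem_scaledBox W hdata hp hns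
  exact (isCompact_setOf_mat_mem_scaledBox W (pow_ne_zero M (Nat.cast_ne_zero.2 hp))).of_isClosed_subset
    (isClosed_torusFinAt W _) (torusFinAt_subset_setOf_mat_mem_scaledBox W hM)

/-- **C-L4-TS-COMPACT, general form**: `CompactSpace (torusFinAt W (placesAbove p))` — the (E1) displayed binder `hTS` of
`exists_isFundamentalDomain_prod_univ_of_compactSpace_at` (AwayDomain), discharged. -/
theorem compactSpace_torusFinAt_of_nonsplit (W : PlaneData k) {d : k} (hdata : HasTorusData W d) {p : ℕ} (hp : p ≠ 0)
    (hns : ∀ v ∈ placesAbove (k := k) p, ¬ IsSquare (-(algebraMap k (v.adicCompletion k) d))) :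
    CompactSpace (torusFinAt W (placesAbove p)) :=
  isCompact_iff_compactSpace.1 (isCompact_torusFinAt_of_nonsplit W hdata hp hns)

end Compact

/-! ## Part C — the row planes: `ofLinesRow q a b ε` and the seesaw plane of record -/

section Row

variable {k : Type} [Field k] [NumberField k] (q : QuadData k) (a b ε : k)

/-- **`T_S` is compact on the genuine row plane** `ofLinesRow q a b ε` under `hns` (plan-4's form `¬ IsSquare (t² − 4n)`, `t = 0`). -/
theorem compactSpace_torusFinAt_ofLinesRow_of_nonsplit (ha : a ≠ 0) (hb : b ≠ 0) (hε : ε ≠ 0) (ht : q.t = 0)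
    (hn : ¬ IsSquare (-q.n)) (p : ℕ) (hp : p ≠ 0)
    (hns : ∀ v ∈ placesAbove (k := k) p, ¬ IsSquare (algebraMap k (v.adicCompletion k) (q.t ^ 2 - 4 * q.n))) :
    CompactSpace (torusFinAt (PlaneData.ofLinesRow q a b ε) (placesAbove p)) :=
  compactSpace_torusFinAt_of_nonsplit _ (hasTorusData_ofLinesRow q a b ε ha hb hε ht hn) hp
    fun v hv => not_isSquare_neg_of_not_isSquare_disc ht v (hns v hv)

end Row

section Transported

variable {k : Type} [Field k] [NumberField k] (q : QuadData k) (a b : k) (g g' : Matrix (Fin 4) (Fin 4) k)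
  (hgg' : g * g' = 1) (hg'g : g' * g = 1) (hgΩ : g * (PlaneData.mixedRow q a b).Ω = (PlaneData.mixedRow q a b).Ω * g)

/-- **`T_S` is compact on the seesaw plane of record** `(mixedRow q a b).withTransportedTorus g g' hgg' hg'g hgΩ` under `hns` — the
binder `hTS` of L2-p2's `exists_isFundamentalDomain_prod_univ_withTransportedTorus` (AwayDomainRow), by name. -/
theorem compactSpace_torusFinAt_withTransportedTorus_of_nonsplit (ha : a ≠ 0) (hb : b ≠ 0) (ht : q.t = 0)
    (hn : ¬ IsSquare (-q.n)) (p : ℕ) (hp : p ≠ 0)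
    (hns : ∀ v ∈ placesAbove (k := k) p, ¬ IsSquare (algebraMap k (v.adicCompletion k) (q.t ^ 2 - 4 * q.n))) :
    CompactSpace (torusFinAt ((PlaneData.mixedRow q a b).withTransportedTorus g g' hgg' hg'g hgΩ) (placesAbove p)) :=
  compactSpace_torusFinAt_of_nonsplit _ (hasTorusData_withTransportedTorus q a b g g' hgg' hg'g hgΩ ha hb ht hn) hp
    fun v hv => not_isSquare_neg_of_not_isSquare_disc ht v (hns v hv)

end Transported

end Summit.Ventures.HodgeRepro.Tier4.Line4

end
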